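import Mathlib
import HarnessLib
import Summits.HubbardSuperconductivity.HubbardSuperconductivity.Theorems.KLProgrammeKLRegimeVolumeLimitV11HcovOfDoors
import Summits.HubbardSuperconductivity.HubbardSuperconductivity.Theorems.KLProgrammeKLRegimeTwoVolumeTowerStepCovZeroFlowAllSteps
import Summits.HubbardSuperconductivity.HubbardSuperconductivity.Theorems.KLProgrammeKLRegimeTwoVolumeTowerStepCovZeroSecFlowAllSteps

/-!
# Route `KLProgramme` — crux K3, VL child `KLRegimeVolumeLimitV17F2` (stmt-HubbardSuperconductivity-20440), skeleton «cauchy» v11: THE `hSup` DISCHARGER,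
# part 9 — THE ATOM `Hcov` IS A THEOREM (p3 g17's scale-0 doors close `H0`; seat hubbard-kl-k3c4-p1 g16; `--supports` 20440)

p3 g17's «SCALE-0-STEPCOV» doors `scaleCovData_klStepCov_zero_flow_all` (p639135) and `scaleCovSecData_klStepCov_zero_flow_all` (p639424) are exactly the `j = 0`
bundles the atom `H0` of `…V11HcovOfDoors` asks for, under binders that are a SUBSET of the `k ≥ 1` doors' (`R.WF2`, `0 < U ≤ min (klEngU₀3 P R cc) (1/(R.Gfr 3+1))`,
any `cc`, `klBetaMin ≤ β`, `HistP klPredsV17F2 … 0 n`, `klEngL₃ β U ≤ V`, `klEngM₃ β U V ≤ M`, rate `Λw·4ⁿ ≤ ρ₀`).  Hence: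

* `h0_of_scaleZeroDoors` — `H0` for every `(G, P, Q, R)` with `R.WF2` (`κ₀ = √(8(Λ₁/π+3/128)(1793Λ₁+704)/Λ₁)`, `α₀ = Cα₀/2` so that `α₀/ε_M = Cα₀·M/β`, `s₀` the
  door's literal entry sup, `e₀ = Ce₀`, `ρ₀ := min`; thresholds `U₇ := min (klEngU₀3 P R c) (1/(R.Gfr 3+1))`, `L₂ := max Lstar (klEngL₃ β U)`, `M₂ L b := …`;
  histories of `L` and `b·L` from the tower by `histP_top_of_towerP`);
* **`hcov_of_towerP`** — the atom `Hcov` of `hSupRegBody_of_atoms(B)` for every `(G, P, Q, R)` with `R.WF2`, NO hypothesis left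
  (`hcov_of_doors_and_scaleZero ∘ h0_of_scaleZeroDoors`).

Proofs only; no definition.  Honest framing: plumbing of landed finite-torus bounds; nothing here asserts any stub, K3, VL or superconductivity.
[cite: BenfattoGiulianiMastropietro2006, §2.7 (2.66)–(2.71a), §2.8 (2.80)–(2.81), §3 (3.2)–(3.8)]
-/

noncomputable section

namespace Summit.HubbardSuperconductivity.HubbardSuperconductivity.Theorems.TwoVolumeSource

set_option linter.dupNamespace false -- summit = problem name (single-conjunct summit), D-0017

open Finset Filter Topology Literature.MathematicalPhysics.QuantumLattice GrassmannAlgebra Literature.Probability.LatticeModels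
  Literature.Probability.LatticeModels.BattleFederbush
open Summit.HubbardSuperconductivity.HubbardSuperconductivity.Theorems.KLRegimeSplit
open Summit.HubbardSuperconductivity.HubbardSuperconductivity.Theorems.KLProgrammeLegKernels
open Summit.HubbardSuperconductivity.HubbardSuperconductivity.Theorems.TwoPointAssembly
open Summit.HubbardSuperconductivity.HubbardSuperconductivity.Theorems.EngineV8
open Summit.HubbardSuperconductivity.HubbardSuperconductivity.Theorems.TwoVolumeDefect
open Summit.HubbardSuperconductivity.HubbardSuperconductivity.Theorems.TorusFourierL2

/-- The door's row constant in the `ε`-scaling: `Cα₀·(M/β) ≤ (Cα₀/2)/ε_M` (an equality; `ε_M = β/(2M)`). [folklore] -/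
theorem row_zero_door_le {Cα₀ β : ℝ} {M : ℕ} (hβ : 0 < β) (hM : 0 < (M : ℝ)) : Cα₀ * ((M : ℝ) / β) ≤ Cα₀ / 2 / imagTimeWeight β M := by
  have hε : imagTimeWeight β M = β / (2 * M) := rfl
  rw [hε]
  apply le_of_eq
  field_simp

set_option maxHeartbeats 3200000 in -- long binders
/-- **`H0` FROM p3 g17's SCALE-0 DOORS** (see the module docstring). [cite: BenfattoGiulianiMastropietro2006, §2.7 (2.66)–(2.67), §2.8 (2.80)–(2.81), §3 (3.2)–(3.8)] -/
theorem h0_of_scaleZeroDoors (G : GeoConsts) (P : SplitConsts) (Q : EngConsts) (R : RenConsts) (hR2 : R.WF2) :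
      ∃ κ₀ α₀ s₀ e₀ ρ₀ : ℝ, 0 < κ₀ ∧ 0 < α₀ ∧ 0 ≤ s₀ ∧ 0 ≤ e₀ ∧ 0 < ρ₀ ∧
        ∃ c₇ : ℝ, 0 < c₇ ∧ ∀ c : ℝ, 0 < c → c ≤ c₇ → ∃ U₇ : ℝ, 0 < U₇ ∧
          ∀ μ ∈ klWindowC, ∀ U : ℝ, 0 < U → U ≤ U₇ → ∀ β : ℝ, klBetaMin ≤ β → β ≤ Real.exp (c / U ^ 2) →
            ∀ (K : TrigPolyC4v) (Lstar : ℕ) (Mstar : ℕ → ℕ), TowerP klPredsV17F2 G P Q R β U μ K Lstar Mstar →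
            ∀ Λ : ℝ, 0 ≤ Λ → Λ * (4 : ℝ) ^ (nScales β + 1) ≤ ρ₀ → 1 ≤ nScales β →
            ∃ L₂ : ℕ, ∃ M₂ : ℕ → ℕ → ℕ, ∀ (L b M : ℕ) [NeZero L] [NeZero (b * L)] [NeZero M], L₂ ≤ L → M₂ L b ≤ M →
              ScaleCovData (klStepCov L M β μ (klFlowFrameU L M β U μ (nScales β + 1)) 0) Λ κ₀ (α₀ / imagTimeWeight β M) s₀ ∧
              ScaleCovData (klStepCov (b * L) M β μ (klFlowFrameU (b * L) M β U μ (nScales β + 1)) 0) Λ κ₀ (α₀ / imagTimeWeight β M) s₀ ∧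
              ScaleCovData (klStepCov (b * L) M β μ (klFlowFrameU L M β U μ (nScales β + 1)) 0) Λ κ₀ (α₀ / imagTimeWeight β M) s₀ ∧
              ScaleCovSecData (klStepCov (b * L) M β μ (klFlowFrameU L M β U μ (nScales β + 1)) 0) Λ e₀ := by
  obtain ⟨Cκ₀, Cα₀, Cs₀, ρ₀, hCκ₀, hCα₀, hCs₀, hρ₀, hcov0⟩ := scaleCovData_klStepCov_zero_flow_all
  obtain ⟨Ce₀, ρe, hCe₀, hρe, hsec0⟩ := scaleCovSecData_klStepCov_zero_flow_all
  have hΛ1 : 0 < klScale klE0 1 := klth_klScale_pos 1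
  have hs₀ : 0 ≤ 8 * (klScale klE0 1 / Real.pi + 3 / 128) * (1793 * klScale klE0 1 + 704) / klScale klE0 1 := by positivity
  refine ⟨Real.sqrt (8 * (klScale klE0 1 / Real.pi + 3 / 128) * (1793 * klScale klE0 1 + 704) / klScale klE0 1), Cα₀ / 2,
    8 * (klScale klE0 1 / Real.pi + 3 / 128) * (1793 * klScale klE0 1 + 704) / klScale klE0 1, Ce₀, min ρ₀ ρe,
    Real.sqrt_pos.2 (by positivity), by positivity, hs₀, hCe₀.le, lt_min hρ₀ hρe, 1, one_pos, fun c hc _ => ?_⟩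
  refine ⟨min (klEngU₀3 P R c) (1 / (R.Gfr 3 + 1)), lt_min (klEngU₀3_pos P R c) (by have := hR2.wf.2.2 3; positivity),
    fun μ hμ U hU hUU β hβmin hβc K Lstar Mstar hT Λ hΛ0 hΛρ hN => ?_⟩
  have hβ : 0 < β := KLRegimeSplit.pos_of_klBetaMin_le hβmin
  have hn1 : 1 ≤ nScales β + 1 := Nat.le_add_left 1 _
  have hΛρ₀ : Λ * (4 : ℝ) ^ (nScales β + 1) ≤ ρ₀ := hΛρ.trans (min_le_left _ _)
  have hΛρe : Λ * (4 : ℝ) ^ (nScales β + 1) ≤ ρe := hΛρ.trans (min_le_right _ _)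
  refine ⟨max Lstar (klEngL₃ β U), fun L b => max (max (Mstar L) (Mstar (b * L))) (max (klEngM₃ β U L) (klEngM₃ β U (b * L))),
    fun L b M _ _ _ hL hM => ?_⟩
  dsimp only at hM
  have hLs : Lstar ≤ L := by omega
  have hL3 : klEngL₃ β U ≤ L := by omega
  have hMs : Mstar L ≤ M := by omega
  have hMsb : Mstar (b * L) ≤ M := by omega
  have hM3 : klEngM₃ β U L ≤ M := by omega
  have hM3b : klEngM₃ β U (b * L) ≤ M := by omega
  have hb1 : 1 ≤ b := Nat.pos_of_ne_zero fun hb => NeZero.ne (b * L) (by rw [hb, Nat.zero_mul])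
  have hLbL : L ≤ b * L := Nat.le_mul_of_pos_left L hb1
  have hL3b : klEngL₃ β U ≤ b * L := hL3.trans hLbL
  have hMβ : β ≤ (M : ℝ) := le_of_klEngM₃_le hβmin hL3 hM3
  have hM0 : (0 : ℝ) < M := lt_of_lt_of_le hβ hMβ
  have hhist : HistP klPredsV17F2 L M G P Q R β U μ 0 (nScales β + 1) := histP_top_of_towerP hT hLs hMs
  have hhistb : HistP klPredsV17F2 (b * L) M G P Q R β U μ 0 (nScales β + 1) := histP_top_of_towerP hT (hLs.trans hLbL) hMsb
  have hconv : ∀ {V : ℕ} [NeZero V] {Kx : TrigPolyC4v},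
      ScaleCovData (klStepCov V M β μ Kx 0) Λ (Real.sqrt (8 * (klScale klE0 1 / Real.pi + 3 / 128) * (1793 * klScale klE0 1 + 704) / klScale klE0 1))
        (Cα₀ * ((M : ℝ) / β)) (8 * (klScale klE0 1 / Real.pi + 3 / 128) * (1793 * klScale klE0 1 + 704) / klScale klE0 1) →
      ScaleCovData (klStepCov V M β μ Kx 0) Λ (Real.sqrt (8 * (klScale klE0 1 / Real.pi + 3 / 128) * (1793 * klScale klE0 1 + 704) / klScale klE0 1))
        (Cα₀ / 2 / imagTimeWeight β M) (8 * (klScale klE0 1 / Real.pi + 3 / 128) * (1793 * klScale klE0 1 + 704) / klScale klE0 1) :=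
    fun h => scaleCovData_mono' h le_rfl (row_zero_door_le hβ hM0) le_rfl
  exact ⟨hconv (hcov0 G P R Q c hR2 μ U hU hUU β hβmin L M (nScales β + 1) hn1 le_rfl hhist L hL3 hM3 Λ hΛ0 hΛρ₀),
    hconv (hcov0 G P R Q c hR2 μ U hU hUU β hβmin (b * L) M (nScales β + 1) hn1 le_rfl hhistb (b * L) hL3b hM3b Λ hΛ0 hΛρ₀),
    hconv (hcov0 G P R Q c hR2 μ U hU hUU β hβmin L M (nScales β + 1) hn1 le_rfl hhist (b * L) hL3b hM3b Λ hΛ0 hΛρ₀),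
    hsec0 G P R Q c hR2 μ U hU hUU β hβmin L M (nScales β + 1) hn1 le_rfl hhist (b * L) Λ hΛ0 hΛρe⟩

set_option maxHeartbeats 1600000 in -- long binders
/-- **THE ATOM `Hcov` IS A THEOREM** (see the module docstring). [cite: BenfattoGiulianiMastropietro2006, §2.7 (2.70)–(2.71a), §2.8 (2.80)–(2.81), §3 (3.2)–(3.8)] -/
theorem hcov_of_towerP
    (G : GeoConsts) (P : SplitConsts) (Q : EngConsts) (R : RenConsts) (hG : G.WF) (hP : P.WF) (hQ : Q.WF) (hR2 : R.WF2) :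
      ∃ k₁ a₁ s₁ e₁ w₁ ρ : ℝ, 0 < k₁ ∧ 0 < a₁ ∧ 0 ≤ s₁ ∧ 0 ≤ e₁ ∧ 1 ≤ w₁ ∧ 0 < ρ ∧
        ∃ c₇ : ℝ, 0 < c₇ ∧ ∀ c : ℝ, 0 < c → c ≤ c₇ → ∃ U₇ : ℝ, 0 < U₇ ∧
          ∀ μ ∈ klWindowC, ∀ U : ℝ, 0 < U → U ≤ U₇ → ∀ β : ℝ, klBetaMin ≤ β → β ≤ Real.exp (c / U ^ 2) →
            ∀ (K : TrigPolyC4v) (Lstar : ℕ) (Mstar : ℕ → ℕ), TowerP klPredsV17F2 G P Q R β U μ K Lstar Mstar →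
            ∀ Λ : ℝ, 0 ≤ Λ → Λ ≤ klScale klE0 (nScales β + 1) → Λ * (4 : ℝ) ^ (nScales β + 1) ≤ ρ →
            ∃ L₂ : ℕ, ∃ M₂ : ℕ → ℕ → ℕ, ∀ (L b M : ℕ) [NeZero L] [NeZero (b * L)] [NeZero M], L₂ ≤ L → M₂ L b ≤ M →
              (∀ j, j < nScales β → ScaleCovData (klStepCov L M β μ (klFlowFrameU L M β U μ (nScales β + 1)) j) Λ (Real.sqrt (k₁ ^ 2 * ((8 : ℝ) ^ j)⁻¹))
                (a₁ * (4 : ℝ) ^ j / imagTimeWeight β M) s₁) ∧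
              (∀ j, j < nScales β → ScaleCovData (klStepCov (b * L) M β μ (klFlowFrameU (b * L) M β U μ (nScales β + 1)) j) Λ (Real.sqrt (k₁ ^ 2 * ((8 : ℝ) ^ j)⁻¹))
                (a₁ * (4 : ℝ) ^ j / imagTimeWeight β M) s₁) ∧
              (∀ j, j < nScales β → ScaleCovData (klStepCov (b * L) M β μ (klFlowFrameU L M β U μ (nScales β + 1)) j) Λ (Real.sqrt (k₁ ^ 2 * ((8 : ℝ) ^ j)⁻¹))
                (a₁ * (4 : ℝ) ^ j / imagTimeWeight β M) s₁) ∧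
              (∀ j, j < nScales β → ScaleCovSecData (klStepCov (b * L) M β μ (klFlowFrameU L M β U μ (nScales β + 1)) j) Λ e₁) ∧
              (∀ j, j ≤ nScales β → TransferWtData (klTowerTransfer (b * L) M β μ (klFlowFrameU L M β U μ (nScales β + 1)) j)
                (klBlockEquivD L b M j) (klBlockEquivD L b M (j - 1)) Λ w₁) :=
  hcov_of_doors_and_scaleZero (fun G P Q R _ _ _ hR2 => h0_of_scaleZeroDoors G P Q R hR2) G P Q R hG hP hQ hR2

end Summit.HubbardSuperconductivity.HubbardSuperconductivity.Theorems.TwoVolumeSource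

end
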